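import Mathlib
import HarnessLib
import Summits.HubbardSuperconductivity.HubbardSuperconductivity.Theorems.KLProgrammeKLRegimeSplitTwoLegF

/-!
# K3 ENGINE child (stmt-HubbardSuperconductivity-20236 `KLRegimeEngineV16`) — crux DECOMP C4a/C4b inside the two-leg slot:
# the CURVE-JET predicate of the scale-`n` two-leg piece (per-scale tangential smoothness of the dispersion correction), budget-parametric

Cell gate-hubbard-kl, seat p2 (g10); plan g15 ruling (G7-a) CONTENT GO (STATUS 08:50:35Z (3)): the tier-1 size `‖D² onM ℓ_n‖ ≤ (G.S 2 + Q.S' 2·|U|)·U²`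
of the two-leg slot (`TwoLegSizesT1Fn`, no gain at `j = 2`) is — read where the slot reads it, ON THE FRAME'S FERMI CURVE — the per-scale TANGENTIAL
`C²` bound of the scale-`n` dispersion correction, i.e. DECOMP §2 C4a/C4b (App. C umklapp-corner normal form at second order; BGM 2006 (2.36)/(3.2)
with the `|h|` removed in the KL regime).  It is not an export of generic position machinery on the frame class ((O2) k3c5-p1, (D1)/(D3) p2, memo
HOME/p2-g10/TWOLEG-SCALE0-DOORS-p2g10.md); it gets its own registered stub (`stub_twoLeg_curvature`, next skeleton touch).  This file fixes the
PREDICATE that stub concludes and the two-leg closers consume (p1b's `twoLegPieceFn_eval_zero_tier1_size_le_curve` / `twoLegPieceV13_tier1_size_le_curve`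
read exactly the curve profile below, `klLocalPart_sub_eq_evalM_comp`):

* `klTwoLegCurveProfile L M β U μ K n : ℝ → ℝ` — the CURVE PROFILE `δ_n` of the scale-`n` piece: `δ₀(θ) = ν₀(K)(θ) − K(k_F^K θ)`,
  `δ_{n+1}(θ) = ν_{n+1}(K)(θ) − ν_n(K)(θ)` (`ν_n = klLocalPart`, the symmetrised interpolant of the localised two-leg value read at `klFermiPoint μ K θ`);
  the function piece `ℓ_n = klTwoLegPieceFn … n` is the tube extension `E_μ[δ_n]` of it, so every derivative the slot asks of `onM ℓ_n` is a
  polynomial in the `θ`-derivatives of `δ_n` (tangential jets) and the FIXED extension profile — never a normal derivative of the raw reading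
  ((D3): the raw scale-`n` reading varies normally on the slice scale `Λ_n`, its full Hessian at the curve is `≍ U²·4ⁿ`; only tangential jets are `O(U²)`);
* `curveJetBar c c' U k n = (c k + c' k·|U|)·uPow k U·4^{(k−2)n}` — the `twoLegBar` SHAPE with free constants (`curveJetBar G.S Q.S' = twoLegBar G Q`,
  `curveJetBar_eq_twoLegBar`), so that the fit against the extension operator's absolute numerals is the registrant's choice (budget-parametric slot
  text, as `TwoLegSizesMSWith`);
* **`TwoLegCurveJetBound L M c c' β U μ K n`** — `δ_n` is `C⁴` and `|δ_n^{(k)}(θ)| ≤ curveJetBar c c' U k n` for `k ≤ 4` and every `θ`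
  (orders `0…4`: value `|U|16^{−n}`-law, slope `U²4^{−n}`, curvature `U²` (C4a: no gain, the corner logarithm spent per scale), `U²4ⁿ`, `U²16ⁿ`);
  `TwoLegCurveJetBoundGQ L M G Q …` — the instance at the package's own size fields; accessors `TwoLegCurveJetBound.contDiff/.le`, monotonicity in
  the constants `TwoLegCurveJetBound.mono`.

Statements only (defs + bookkeeping lemmas); nothing about the model is asserted.  The predicate reads the same in a flowing-frame scheme
(HOME/p2-g10/SCHEME-FLOW-VS-CT-p2g10.md): there `K` is the frame accumulated down to scale `n` and `δ_{n+1}` the new increment read on its curve.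
-/

noncomputable section

namespace Summit.HubbardSuperconductivity.HubbardSuperconductivity.Theorems.KLRegimeSplit

set_option linter.dupNamespace false -- summit = problem name (single-conjunct summit), D-0017

open Real Literature.MathematicalPhysics.QuantumLattice Literature.Probability.LatticeModels

section Profile

variable (L M : ℕ) [NeZero L] [NeZero M]

/-- **The curve profile `δ_n` of the scale-`n` two-leg piece** (a function of the polar angle `θ` only): at `n = 0` the scale-`0` local part
minus the frame read at the frame's own Fermi point, `ν₀(K)(θ) − K(k_F^K θ)`; at `n + 1` the increment of local parts `ν_{n+1}(K)(θ) − ν_n(K)(θ)`. -/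
def klTwoLegCurveProfile (β U μ : ℝ) (K : TrigPolyC4v) : ℕ → ℝ → ℝ
  | 0 => fun θ => klLocalPart L M β U μ K 0 θ - K.eval (klFermiPoint μ K θ)
  | n + 1 => fun θ => klLocalPart L M β U μ K (n + 1) θ - klLocalPart L M β U μ K n θ

/-- Unfolding at scale `0`. -/
theorem klTwoLegCurveProfile_zero (β U μ : ℝ) (K : TrigPolyC4v) :
    klTwoLegCurveProfile L M β U μ K 0 = fun θ => klLocalPart L M β U μ K 0 θ - K.eval (klFermiPoint μ K θ) := rfl

/-- Unfolding at scale `n + 1`. -/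
theorem klTwoLegCurveProfile_succ (β U μ : ℝ) (K : TrigPolyC4v) (n : ℕ) :
    klTwoLegCurveProfile L M β U μ K (n + 1) = fun θ => klLocalPart L M β U μ K (n + 1) θ - klLocalPart L M β U μ K n θ := rfl

/-- The profiles telescope: `Σ_{n ≤ N} δ_n(θ) = ν_N(K)(θ) − K(k_F^K θ)` — the renormalisation condition's left side. -/
theorem sum_klTwoLegCurveProfile (β U μ : ℝ) (K : TrigPolyC4v) (N : ℕ) (θ : ℝ) :
    ∑ n ∈ Finset.range (N + 1), klTwoLegCurveProfile L M β U μ K n θ = klLocalPart L M β U μ K N θ - K.eval (klFermiPoint μ K θ) := by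
  induction N with
  | zero => simp [klTwoLegCurveProfile]
  | succ N ih => rw [Finset.sum_range_succ, ih, klTwoLegCurveProfile_succ]; ring

end Profile

/-! ## The budget-parametric jet bar -/

/-- **Curve-jet bar** of the `twoLegBar` shape with free constants: `(c k + c' k·|U|)·uPow k U·4^{(k−2)n}`. -/
def curveJetBar (c c' : ℕ → ℝ) (U : ℝ) (k n : ℕ) : ℝ :=
  (c k + c' k * |U|) * uPow k U * (4 : ℝ) ^ (((k : ℤ) - 2) * n)

/-- Unfolding `curveJetBar`. -/
theorem curveJetBar_apply (c c' : ℕ → ℝ) (U : ℝ) (k n : ℕ) :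
    curveJetBar c c' U k n = (c k + c' k * |U|) * uPow k U * (4 : ℝ) ^ (((k : ℤ) - 2) * n) := rfl

/-- At the package's own size fields the bar IS the slot's `twoLegBar`. -/
theorem curveJetBar_eq_twoLegBar (G : GeoConsts) (Q : EngConsts) (U : ℝ) (k n : ℕ) :
    curveJetBar G.S Q.S' U k n = twoLegBar G Q U k n := rfl

/-- The bar is nonnegative for nonnegative constants. -/
theorem curveJetBar_nonneg {c c' : ℕ → ℝ} (hc : ∀ k, 0 ≤ c k) (hc' : ∀ k, 0 ≤ c' k) (U : ℝ) (k n : ℕ) :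
    0 ≤ curveJetBar c c' U k n := by
  unfold curveJetBar uPow
  have h1 : 0 ≤ c k + c' k * |U| := add_nonneg (hc k) (mul_nonneg (hc' k) (abs_nonneg U))
  have h2 : 0 ≤ (if k = 0 then |U| else U ^ 2) := by split_ifs <;> positivity
  exact mul_nonneg (mul_nonneg h1 h2) (zpow_nonneg (by norm_num) _)

/-- The bar is monotone in the constants. -/
theorem curveJetBar_mono {c c' d d' : ℕ → ℝ} (hcd : ∀ k, c k ≤ d k) (hcd' : ∀ k, c' k ≤ d' k) (U : ℝ) (k n : ℕ) :
    curveJetBar c c' U k n ≤ curveJetBar d d' U k n := by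
  unfold curveJetBar uPow
  have h2 : 0 ≤ (if k = 0 then |U| else U ^ 2) := by split_ifs <;> positivity
  have h3 : (0 : ℝ) ≤ (4 : ℝ) ^ (((k : ℤ) - 2) * n) := zpow_nonneg (by norm_num) _
  have h1 : c k + c' k * |U| ≤ d k + d' k * |U| := add_le_add (hcd k) (mul_le_mul_of_nonneg_right (hcd' k) (abs_nonneg U))
  exact mul_le_mul_of_nonneg_right (mul_le_mul_of_nonneg_right h1 h2) h3

/-! ## The curve-jet predicate (what `stub_twoLeg_curvature` concludes; what the two-leg tier-1 closers read) -/

section Jet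

variable (L M : ℕ) [NeZero L] [NeZero M]

/-- **`TwoLegCurveJetBound L M c c' β U μ K n`** — C4a PER SCALE, budget-parametric: the curve profile `δ_n` of the scale-`n` two-leg piece is
`C⁴` in the polar angle and every `θ`-derivative of order `k ≤ 4` is within `curveJetBar c c' U k n` at every `θ` (value, slope, CURVATURE —
order `2` has no scale gain —, and the orders `3, 4` with the `4ⁿ`, `16ⁿ` allowances of BGM (2.36)/(2.42)). -/
def TwoLegCurveJetBound (c c' : ℕ → ℝ) (β U μ : ℝ) (K : TrigPolyC4v) (n : ℕ) : Prop :=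
  ContDiff ℝ 4 (klTwoLegCurveProfile L M β U μ K n) ∧
    ∀ k ≤ 4, ∀ θ : ℝ, |iteratedDeriv k (klTwoLegCurveProfile L M β U μ K n) θ| ≤ curveJetBar c c' U k n

/-- **The instance at the package's size fields**: `TwoLegCurveJetBoundGQ L M G Q … n := TwoLegCurveJetBound L M G.S Q.S' … n` (bars = `twoLegBar G Q U k n`). -/
def TwoLegCurveJetBoundGQ (G : GeoConsts) (Q : EngConsts) (β U μ : ℝ) (K : TrigPolyC4v) (n : ℕ) : Prop :=
  TwoLegCurveJetBound L M G.S Q.S' β U μ K n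

variable {L M}

/-- Unfolding the `(G,Q)` instance. -/
theorem twoLegCurveJetBoundGQ_iff (G : GeoConsts) (Q : EngConsts) (β U μ : ℝ) (K : TrigPolyC4v) (n : ℕ) :
    TwoLegCurveJetBoundGQ L M G Q β U μ K n ↔
      ContDiff ℝ 4 (klTwoLegCurveProfile L M β U μ K n) ∧
        ∀ k ≤ 4, ∀ θ : ℝ, |iteratedDeriv k (klTwoLegCurveProfile L M β U μ K n) θ| ≤ twoLegBar G Q U k n :=
  Iff.rfl

/-- Accessor: smoothness of the profile. -/
theorem TwoLegCurveJetBound.contDiff {c c' : ℕ → ℝ} {β U μ : ℝ} {K : TrigPolyC4v} {n : ℕ}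
    (h : TwoLegCurveJetBound L M c c' β U μ K n) : ContDiff ℝ 4 (klTwoLegCurveProfile L M β U μ K n) := h.1

/-- Accessor: the jet bound at order `k ≤ 4`. -/
theorem TwoLegCurveJetBound.le {c c' : ℕ → ℝ} {β U μ : ℝ} {K : TrigPolyC4v} {n : ℕ}
    (h : TwoLegCurveJetBound L M c c' β U μ K n) {k : ℕ} (hk : k ≤ 4) (θ : ℝ) :
    |iteratedDeriv k (klTwoLegCurveProfile L M β U μ K n) θ| ≤ curveJetBar c c' U k n := h.2 k hk θ

/-- Accessor, order `0` (the VALUE on the curve): `|δ_n(θ)| ≤ (c 0 + c' 0·|U|)·|U|·16^{−n}`. -/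
theorem TwoLegCurveJetBound.abs_le {c c' : ℕ → ℝ} {β U μ : ℝ} {K : TrigPolyC4v} {n : ℕ}
    (h : TwoLegCurveJetBound L M c c' β U μ K n) (θ : ℝ) :
    |klTwoLegCurveProfile L M β U μ K n θ| ≤ curveJetBar c c' U 0 n := by
  simpa only [iteratedDeriv_zero] using h.2 0 (by norm_num) θ

/-- Accessor, order `2` (the CURVATURE clause, C4a: `≤ (c 2 + c' 2·|U|)·U²`, no scale factor). -/
theorem TwoLegCurveJetBound.curvature_le {c c' : ℕ → ℝ} {β U μ : ℝ} {K : TrigPolyC4v} {n : ℕ}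
    (h : TwoLegCurveJetBound L M c c' β U μ K n) (θ : ℝ) :
    |iteratedDeriv 2 (klTwoLegCurveProfile L M β U μ K n) θ| ≤ (c 2 + c' 2 * |U|) * U ^ 2 := by
  have h2 := h.2 2 (by norm_num) θ
  simp only [curveJetBar, uPow, show (2 : ℕ) ≠ 0 from by norm_num, if_false, Nat.cast_ofNat, sub_self, zero_mul, zpow_zero,
    mul_one] at h2
  exact h2

/-- **Monotonicity in the constants**: a jet bound with smaller constants implies the one with larger constants (the registrant's fit). -/
theorem TwoLegCurveJetBound.mono {c c' d d' : ℕ → ℝ} (hcd : ∀ k, c k ≤ d k) (hcd' : ∀ k, c' k ≤ d' k) {β U μ : ℝ} {K : TrigPolyC4v}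
    {n : ℕ} (h : TwoLegCurveJetBound L M c c' β U μ K n) : TwoLegCurveJetBound L M d d' β U μ K n :=
  ⟨h.1, fun k hk θ => (h.2 k hk θ).trans (curveJetBar_mono hcd hcd' U k n)⟩

/-- **From the parametric bound to the package instance**: constants `≤ (G.S, Q.S')` give `TwoLegCurveJetBoundGQ`. -/
theorem twoLegCurveJetBoundGQ_of_le (G : GeoConsts) (Q : EngConsts) {c c' : ℕ → ℝ} (hc : ∀ k, c k ≤ G.S k) (hc' : ∀ k, c' k ≤ Q.S' k)
    {β U μ : ℝ} {K : TrigPolyC4v} {n : ℕ} (h : TwoLegCurveJetBound L M c c' β U μ K n) : TwoLegCurveJetBoundGQ L M G Q β U μ K n :=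
  h.mono hc hc'

end Jet

end Summit.HubbardSuperconductivity.HubbardSuperconductivity.Theorems.KLRegimeSplit

end
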